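import Literature.MathematicalPhysics.QuantumFieldTheory.Balaban1983to89.B9Eq326G1kSupRowClosed
import Literature.MathematicalPhysics.QuantumFieldTheory.Balaban1983to89.B9Eq326G1PostcompRowOfLetters
import Literature.MathematicalPhysics.QuantumFieldTheory.Balaban1983to89.B9Eq326LocalInvTowerSliceGradientRowClosed

/-!
# `Balaban1983to89.B9Eq326G1kSliceGradRowClosed` — T. Bałaban, *Propagators for lattice gauge theories in a background field*, Commun. Math. Phys. **99** (1985)
# 389–434 [Balaban1985BackgroundPropagators] Thm 3.3 p. 399 (*«the operator G(U) satisfies the inequalities (3.42)–(3.47), with G′(U) replaced by G(U) and λ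
# replaced by a function defined at bonds»*), Thm 3.1 (3.42) p. 397 SECOND ENTRY *«|(∇_U Gλ)(x)| ≤ B₀e^{−δ₀d(y,y′)}|λ|»*, (3.3) p. 391, (3.25)–(3.27) pp. 394–395,
# Thm 3.11 p. 416, Thm 3.13 p. 426, with [Balaban1985Variational] (115) p. 294, (117) p. 295: **THE COVARIANT (SLICE) GRADIENT ROW OF THE TOWER BOND PROPAGATOR
# `G₁,k(U) = Δ_{a,k}(U)⁻¹` ON PRINT's DIAGONAL WITH `∃ (α₁, B, δ)` BEFORE THE HEIGHT, THE PERIOD AND THE BACKGROUND — `‖(D_U(G₁,kf)_μ)(b)‖ ≤ B·e^{−δ·d_m(Π(b₊),v)}·F`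
# and `‖(∇_UG₁,kf)(b, μ)‖ ≤ B·e^{−δ·d_m(Π(b₊),v)}·F` for `f` supported over ONE unit block `v` with `‖f‖_∞ ≤ F` — THE GRADIENT MEMBER OF (117) FOR `G₁,k`
# (the `|∇·|_{(−2)}` half of the space (115)'s norm of `𝔊̃_k = 𝔓_kG₁,k`), UNCONDITIONAL on the cell's MODEL letters** — the instantiation of this lineage's
# post-composed Woodbury assembly `B9Eq326G1PostcompRowOfLetters.local_letter_postcomp_torus_const` at `D :=` the slice derivative `u ↦ D_U u_μ` (an explicit
# continuous linear map of the carriers, no definition), outer letter := this lineage's (VGRC) `B9Eq326LocalInvTowerSliceGradientRowClosed`, every other letter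
# EXACTLY as ne9-leaf-05's (K64) `B9Eq326G1kSupRowClosed` (binder block VERBATIM = beta-an4's `exists_local_letter_G1k` + `(μ : Fin d)`); NE9 owner INTENT-6 gen 96

statement-level skeleton of published theorems with citation tags; proofs where landed; nothing here is a claim about the Yang–Mills mass gap

CITATION HEADER (lean-in-tree rule).  Audit cell `pub-balaban`, sub-cell `t4`, BINDER row NE9; filed by the NE9 BINDER-row OWNER lineage `b2b-balaban-t4-ne9-p1` (gen 96).
Imports (K64), (E1), (VGRC).  SOURCE READ first-hand in the held text layer [Balaban1985BackgroundPropagators] (`paper:balaban1985-cmp99-background-propagators`): p. 391 (3.3);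
pp. 394–395 (3.25)–(3.27); p. 397 Thm 3.1 (3.42); p. 399 Thm 3.3; p. 416 Thm 3.11; p. 426 Thm 3.13; [Balaban1985Variational] p. 294 (115), p. 295 (117).  Print's random
walk is NOT reproduced; [folklore] composition BY NAME; nothing printed is a hypothesis except the model letters.

WHAT IS PROVED (sorry-free; proof lane — 0 `def`; [folklore]).
* §1 **`exists_local_gradLetter_G1k_of_UuLetter`** — (K64) §1's shape: MODULO the displayed `∃`-first letter `HU` of `Uu = D_UG′_kQ̃′_k†` (the SAME `HU` as (K64)'s,
  byte for byte), `∃ α₁ B δ` with, on (K64)'s binder block + `(μ : Fin d)`, BOTH readings of the slice-gradient row of `G₁,kf`.  Proof = (K64) §1's with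
  `local_letter_G1_torus_const ↦ local_letter_postcomp_torus_const` at `D :=` the slice-derivative CLM (`⟨_, fun _ _ => rfl⟩`), `π_X := Π∘btgt`, the outer letter
  `hDA` := (VGRC) `exists_sliceGradRow_localInvK_diagonal_closed` weakened to the common rate, and FIVE suppliers' windows∕rates under one `min`.
* §2 **`exists_local_gradLetter_G1k`** — `HU` INHABITED exactly as (K64) §2 (the OWNER's (GRC) `exists_gradRow_GpOfUk` on the unit point sources `Q̃′_k†g`,
  support∕size∕tip→base junction) — THE END, unconditional on the model letters.
HONEST SCOPE.  Composition BY NAME; constants symbolic and crude; the MODEL letters, `hRlev` and the positivity witnesses `hpos′`∕`hpos` (∀-quantified; inhabited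
on the model by ne9-leaf-03's `B9Eq3126H1RowLettersDiagonalClosed`) stay DISPLAYED exactly as in (K64); the VALUE-member twin (`D := D*_U`, outer letter (DVTD)) and the
(117) operator bound itself (`B11Eq115KernelOp.kernelJetCLM`, the words `𝔓_k`, `H₁,k`) are NOT here; nothing of [B9] Thm 3.1∕3.3∕3.11∕3.13 is asserted, valued or
discharged.  NOT NE9 (cell pub-balaban: NE9 NOT PRINTED ∕ NOT PROVED; «NE9 ⇐ the named binders»; row WALLED ON A MODEL (O-NE9-1; #5 UNRULED); spine PROVED 0∕9; rung
(B)+1 on a finite T⁴ — NOT infinite volume, NOT mass gap, NOT BetaPertH, NOT Clay; HONEST DEPENDENCY: continuum YM on T⁴ ⇐ BetaPertH ∧ nine spine estimates (0/9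
proved); BetaPertH ⇐ (D1) ∧ (D4) ∧ CAP+tail; G-an2-4 gates asym, D1 and NE2/3/4).  NEW file; nothing modified.  Net new unproved facts: 0.
-/

noncomputable section

set_option autoImplicit false

open scoped InnerProductSpace ComplexConjugate BigOperators

namespace Literature.MathematicalPhysics.QuantumFieldTheory.Balaban1983to89.B9Eq326G1kSliceGradRowClosed

open B4Sect5Torus (TSite tdist tdist_nonneg tdist_triangle)
open B4Sect5Proof (latticeConst latticeConst_nonneg)
open B9SectCLatticeCarrier (Bond DirPair bpos btgt unshift)
open B9Eq311L2Pairing (WL2)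
open B9Eq33CovDerivVector (covGrad)
open B9Eq319QprimeTorus (fineP blockCoord)
open B7Prop1Explicit (U1 Wcx boxVec)
open B11Eq103H1Complex (SiteL2K BondL2K greenK covDerivL2K covDivL2K)
open B9Eq310DeltaPrime (plaqHolU)
open B9Eq310HessianOperator (adTransportW hessOp)
open B9Eq310HessianHermitian (adTransportW_adjoint)
open B9Eq315QTorus (perCfg cornerSite)
open B9Eq315QTower (towerP UlevOf)
open B9Eq316TowerFlatIsOneStep (towerP_eq_fineP_pow siteCast)
open B9Eq326OperatorTower (QkW QprimeTowerW laplaceAk G1k)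
open B9Eq324DeltaPrimeATower (laplacePrimeAk GpOfUk)
open B9Eq325ProjFormulaTower (QGGQk_pos)
open B9Eq349BlockMultipliers (exists_block_clm_family)
open B9Eq326LocalPartCoerciveTower (localK_pos_of_pos)
open B9Eq326WoodburySchurTower (G1k_eq_woodbury)
open B9Eq326WoodburyLettersTower (adjoint_toContinuousLinearMap_Uu adjoint_localInvK exists_local_letter_QGGQInvk_closed)
open B9Eq326LocalPartTowerSupDecayDiagonalClosed (sum_bondMass_bigBlock_le exists_sup_decay_localInvK_diagonal_closed)
open B9Eq326DeltaABlockDecayTowerDiagonalClosed (exists_block_decay_G1k_diagonal_closed)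
open B9Eq326G1PostcompRowOfLetters (local_letter_postcomp_torus_const)
open B9Eq342GreenPrimeTowerGradientRowClosed (exists_gradRow_GpOfUk)
open B9Eq324PenaltyPointwiseBound (norm_adjoint_QtildeTower_apply_le)
open B9Eq324PenaltyBlockLocal (adjoint_QtildeTower_apply_eq_of_eq_at)
open B9Eq342GreenPrimeTowerSupBoundDecay (bigBlock_eq_iff)
open B9Eq33CovDerivLocalLetterTower (tdist_bigBlock_bpos_btgt_le_one)
open B9Eq347LocalFromBlockDecay (norm_le_sqrt_mass_mul)
open B9Eq326LocalPartTowerSliceGradientRow (norm_covGrad_apply_le_of_slice)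
open B9Eq326LocalInvTowerSliceGradientRowClosed (exists_sliceGradRow_localInvK_diagonal_closed)

variable {d : ℕ} (hd : 1 ≤ d) (L : ℕ) [NeZero L] (hL : 1 ≤ L) (hL3 : 3 ≤ L)
  {𝔸 : Type*} [NormedRing 𝔸] [NormedAlgebra ℂ 𝔸] [CompleteSpace 𝔸] [NormOneClass 𝔸] [StarRing 𝔸] [NormedStarGroup 𝔸] [StarModule ℂ 𝔸]
  {W : Type*} [NormedAddCommGroup W] [InnerProductSpace ℂ W] [FiniteDimensional ℂ W] (φ : W ≃ₗ[ℂ] 𝔸)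
  {Mφ Mφ' : ℝ} (hMφ : 0 ≤ Mφ) (hMφ' : 0 ≤ Mφ') (hφ : ∀ w, ‖φ w‖ ≤ Mφ * ‖w‖) (hφ' : ∀ X, ‖φ.symm X‖ ≤ Mφ' * ‖X‖) (hstar : ∀ X : 𝔸, ‖star X‖ ≤ ‖X‖)
  {a : ℝ} (ha : 0 < a) {a' : ℝ} (ha' : 0 < a') {ϱ : ℝ} (hϱ0 : 0 ≤ ϱ) (hϱ1 : ϱ < 1)
  (τ : 𝔸 →ₗ[ℂ] ℂ) {Cτ : ℝ} (hτ : ∀ X, ‖τ X‖ ≤ Cτ * ‖X‖) (hCτ : 0 ≤ Cτ) {Mτ : ℝ} (hτm : ∀ X Y : 𝔸, ‖τ (X * Y)‖ ≤ Mτ * ‖X‖ * ‖Y‖) (hMτ : 0 ≤ Mτ)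
  {ρw : ℝ} (hρw : 0 ≤ ρw)
  (hτ₁ : ∀ X : 𝔸, τ (star X) = conj (τ X)) (hτ₂ : ∀ X Y : 𝔸, τ (X * Y) = τ (Y * X)) (hφτ : ∀ X Y : 𝔸, ⟪φ.symm X, φ.symm Y⟫_ℂ = τ (star X * Y))
  (AQ : ℝ)

set_option maxHeartbeats 400000 in -- (K64)'s ≈ 45 binders + five suppliers + the slice CLM: the final defeq assembly exceeds the default budget
include hd hL hL3 hMφ hMφ' hφ hφ' hstar ha ha' hϱ0 hϱ1 hτ hCτ hτm hMτ hρw hτ₁ hτ₂ hφτ in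
/-- **THE SLICE-GRADIENT ROW OF `G₁,k(U)` ON PRINT's DIAGONAL, `∃ α₁ B δ` BEFORE THE HEIGHT — MODULO THE DISPLAYED `∃`-FIRST LETTER OF `Uu = D_UG′_kQ̃′_k†`** (`HU`,
(K64)'s byte for byte).  Composition BY NAME of `local_letter_postcomp_torus_const` with `D :=` the slice derivative `u ↦ D_U u_μ`, `hW` := `G1k_eq_woodbury`,
`hVadj`∕`hAadj`∕`hC` := `B9Eq326WoodburyLettersTower`, (L)(D∘A₀,k⁻¹) := (VGRC), (L)(A₀,k⁻¹) := (ECL), `hGblk` := (FCLG), the families by `exists_block_clm_family`, the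
bond-block mass `d·c₁` by (ECL) §1. [cite: Balaban1985BackgroundPropagators, Thm 3.3 p.399, Thm 3.1 (3.42) p.397, (3.3) p.391, (3.25)–(3.26) pp.394–395, Thm 3.11
p.416, Thm 3.13 p.426; Balaban1985Variational, (115) p.294, (117) p.295] -/
theorem exists_local_gradLetter_G1k_of_UuLetter
    (HU : ∃ α₂ BU κU : ℝ, 0 < α₂ ∧ 0 ≤ BU ∧ 0 < κU ∧
      ∀ (n : ℕ) (η : ℝ) (_hηL : η * (L : ℝ) ^ (n + 1) = 1) (c₀ c₁ : ℝ) [Fact (0 < c₀)] [Fact (0 < c₁)]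
        (_hw : c₀ * ((L : ℝ) ^ (n + 1)) ^ d = c₁) (_hρ : |η| ^ d / c₀ ≤ ρw) (m : Fin d → ℕ) [∀ i, NeZero (m i)] (_hm : ∀ i, 1 ≤ m i)
        (U : Bond d (towerP L m (n + 1)) → 𝔸ˣ) (αU : ℕ → ℝ) (_hα0 : ∀ j, 0 ≤ αU j) (hα1 : ∀ j, αU j ≤ 1 / 64)
        (hU1 : ∀ (j : ℕ) (x : B7Prop1Explicit.Site d) (k : Fin d), perCfg (towerP L m (j + 1)) (UlevOf L m (n + 1) U j) x k ∈ U1 𝔸)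
        (hreg : ∀ (j : ℕ) (y : TSite d (towerP L m j)) (k : Fin d) (ρ' : Fin d → Fin L),
          ‖((Wcx L (perCfg (towerP L m (j + 1)) (UlevOf L m (n + 1) U j)) (cornerSite L y) k (boxVec L ρ') : 𝔸ˣ) : 𝔸) - 1‖ ≤ αU j)
        (εU : ℕ → ℝ) (_hεU : ∀ j, 0 ≤ εU j) (_hUε : ∀ (j : ℕ) (b : Bond d (towerP L m (j + 1))), ‖(UlevOf L m (n + 1) U j b : 𝔸) - 1‖ ≤ εU j)
        (_hLb : ∀ (j : ℕ) (b : Bond d (towerP L m (j + 1))), UlevOf L m (n + 1) U j b ∈ U1 𝔸)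
        (α : ℝ) (_hα : 0 ≤ α) (_hαle : α ≤ α₂)
        (hUst : ∀ b, star (U b : 𝔸) = (((U b)⁻¹ : 𝔸ˣ) : 𝔸)) (_hUb : ∀ b, U b ∈ U1 𝔸) (_hUη : ∀ b, ‖(U b : 𝔸) - 1‖ ≤ α * η)
        (_hpl : ∀ p : B9SectCLatticeCarrier.Plaq d (towerP L m (n + 1)), ‖(plaqHolU U p : 𝔸) - 1‖ ≤ α * η ^ 2)
        (_hUgrad : ∀ (x : TSite d (towerP L m (n + 1))) (μ : Fin d), ‖(U (x, μ) : 𝔸) - U (unshift μ x, μ)‖ ≤ α * η ^ 2)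
        (_hRlev : ∀ (j : ℕ) (b : Bond d (towerP L m (j + 1))) (w : W), ‖adTransportW φ (UlevOf L m (n + 1) U j) b w‖ ≤ ‖w‖)
        (_hεg : ∀ j < n + 1, εU j ≤ α * ϱ ^ j) (_hAQ : ∑ j ∈ Finset.range (n + 1), αU j ≤ AQ)
        (hpos' : ∀ x : SiteL2K ℂ d (towerP L m (n + 1)) c₀ W, x ≠ 0 → 0 < RCLike.re ⟪x, laplacePrimeAk L m n φ η U a' (c₁ := c₁) x⟫_ℂ)
        (v : TSite d m) (g : SiteL2K ℂ d m c₁ W) (Gs : ℝ) (_hgv : ∀ y, y ≠ v → WL2.equiv ℂ (fun _ : TSite d m => c₁) W g y = 0)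
        (_hgG : ∀ y, ‖WL2.equiv ℂ (fun _ : TSite d m => c₁) W g y‖ ≤ Gs) (b : Bond d (towerP L m (n + 1))),
        ‖WL2.equiv ℂ (fun _ : Bond d (towerP L m (n + 1)) => c₀) W
            ((covDerivL2K ℂ c₀ ((η : ℂ))⁻¹ (adTransportW φ U) ∘ₗ GpOfUk L m n φ η U a' (c₁ := c₁) hpos' ∘ₗ
              LinearMap.adjoint ((WL2.linearEquiv ℂ ℂ (fun _ : TSite d m => c₁)).symm.toLinearMap ∘ₗ QprimeTowerW L m n φ U (c₀ := c₀))) g) b‖ ≤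
          BU * Real.exp (-(κU * tdist m (blockCoord (L ^ (n + 1)) m (siteCast (towerP_eq_fineP_pow L m (n + 1)) (bpos b))) v)) * Gs) :
    ∃ α₁ B δ : ℝ, 0 < α₁ ∧ 0 ≤ B ∧ 0 < δ ∧
      ∀ (n : ℕ) (η : ℝ) (_hηL : η * (L : ℝ) ^ (n + 1) = 1) (c₀ c₁ : ℝ) [Fact (0 < c₀)] [Fact (0 < c₁)]
        (_hw : c₀ * ((L : ℝ) ^ (n + 1)) ^ d = c₁) (_hρ : |η| ^ d / c₀ ≤ ρw) (m : Fin d → ℕ) [∀ i, NeZero (m i)] (_hm : ∀ i, 1 ≤ m i)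
        (U : Bond d (towerP L m (n + 1)) → 𝔸ˣ) (αU : ℕ → ℝ) (_hα0 : ∀ j, 0 ≤ αU j) (hα1 : ∀ j, αU j ≤ 1 / 64)
        (hU1 : ∀ (j : ℕ) (x : B7Prop1Explicit.Site d) (k : Fin d), perCfg (towerP L m (j + 1)) (UlevOf L m (n + 1) U j) x k ∈ U1 𝔸)
        (hreg : ∀ (j : ℕ) (y : TSite d (towerP L m j)) (k : Fin d) (ρ' : Fin d → Fin L),
          ‖((Wcx L (perCfg (towerP L m (j + 1)) (UlevOf L m (n + 1) U j)) (cornerSite L y) k (boxVec L ρ') : 𝔸ˣ) : 𝔸) - 1‖ ≤ αU j)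
        (εU : ℕ → ℝ) (_hεU : ∀ j, 0 ≤ εU j) (_hUε : ∀ (j : ℕ) (b : Bond d (towerP L m (j + 1))), ‖(UlevOf L m (n + 1) U j b : 𝔸) - 1‖ ≤ εU j)
        (_hLb : ∀ (j : ℕ) (b : Bond d (towerP L m (j + 1))), UlevOf L m (n + 1) U j b ∈ U1 𝔸)
        (α : ℝ) (_hα : 0 ≤ α) (_hαle : α ≤ α₁)
        (hUst : ∀ b, star (U b : 𝔸) = (((U b)⁻¹ : 𝔸ˣ) : 𝔸)) (_hUb : ∀ b, U b ∈ U1 𝔸) (_hUη : ∀ b, ‖(U b : 𝔸) - 1‖ ≤ α * η)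
        (_hpl : ∀ p : B9SectCLatticeCarrier.Plaq d (towerP L m (n + 1)), ‖(plaqHolU U p : 𝔸) - 1‖ ≤ α * η ^ 2)
        (_hUgrad : ∀ (x : TSite d (towerP L m (n + 1))) (μ : Fin d), ‖(U (x, μ) : 𝔸) - U (unshift μ x, μ)‖ ≤ α * η ^ 2)
        (_hRlev : ∀ (j : ℕ) (b : Bond d (towerP L m (j + 1))) (w : W), ‖adTransportW φ (UlevOf L m (n + 1) U j) b w‖ ≤ ‖w‖)
        (_hεg : ∀ j < n + 1, εU j ≤ α * ϱ ^ j) (_hAQ : ∑ j ∈ Finset.range (n + 1), αU j ≤ AQ)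
        (hpos' : ∀ x : SiteL2K ℂ d (towerP L m (n + 1)) c₀ W, x ≠ 0 → 0 < RCLike.re ⟪x, laplacePrimeAk L m n φ η U a' (c₁ := c₁) x⟫_ℂ)
        (hpos : ∀ x : BondL2K ℂ d (towerP L m (n + 1)) c₀ W, x ≠ 0 →
          0 < RCLike.re ⟪x, laplaceAk L m n φ η U hL αU hα1 hU1 hreg τ (c₀ := c₀) (c₁ := c₁) a x⟫_ℂ)
        (v : TSite d m) (f : BondL2K ℂ d (towerP L m (n + 1)) c₀ W) (F : ℝ)
        (_hfv : ∀ b, blockCoord (L ^ (n + 1)) m (siteCast (towerP_eq_fineP_pow L m (n + 1)) (bpos b)) ≠ v →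
          WL2.equiv ℂ (fun _ : Bond d (towerP L m (n + 1)) => c₀) W f b = 0)
        (_hfF : ∀ b, ‖WL2.equiv ℂ (fun _ : Bond d (towerP L m (n + 1)) => c₀) W f b‖ ≤ F) (μ : Fin d) (b : Bond d (towerP L m (n + 1))),
        ‖WL2.equiv ℂ (fun _ : Bond d (towerP L m (n + 1)) => c₀) W (covDerivL2K ℂ c₀ ((η : ℂ))⁻¹ (adTransportW φ U) ((WL2.equiv ℂ (fun _ : TSite d (towerP L m (n + 1)) => c₀) W).symm fun y => WL2.equiv ℂ (fun _ : Bond d (towerP L m (n + 1)) => c₀) W (G1k L m n φ η U hL αU hα1 hU1 hreg τ (c₀ := c₀) (c₁ := c₁) hpos f) (y, μ))) b‖ ≤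
            B * Real.exp (-(δ * tdist m (blockCoord (L ^ (n + 1)) m (siteCast (towerP_eq_fineP_pow L m (n + 1)) (btgt b))) v)) * F ∧
          ‖covGrad ((η : ℂ))⁻¹ (adTransportW φ U) (WL2.equiv ℂ (fun _ : Bond d (towerP L m (n + 1)) => c₀) W (G1k L m n φ η U hL αU hα1 hU1 hreg τ (c₀ := c₀) (c₁ := c₁) hpos f)) (b, μ)‖ ≤
            B * Real.exp (-(δ * tdist m (blockCoord (L ^ (n + 1)) m (siteCast (towerP_eq_fineP_pow L m (n + 1)) (btgt b))) v)) * F := by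
  classical
  -- the five `∃`-first suppliers
  obtain ⟨αA, BA, δA, hαA, hBA, hδA, HA⟩ := exists_sup_decay_localInvK_diagonal_closed hd L hL hL3 φ hMφ hMφ' hφ hφ' hstar ha ha' hϱ0 hϱ1 τ hτ hCτ hτm
    hMτ hρw hτ₁ hτ₂ hφτ AQ
  obtain ⟨αD, BDv, δD, hαD, hBDv, hδD, HD⟩ := exists_sliceGradRow_localInvK_diagonal_closed hd L hL hL3 φ hMφ hMφ' hφ hφ' hstar ha ha' hϱ0 hϱ1 τ hτ hCτ
    hτm hMτ hρw hτ₁ hτ₂ hφτ AQ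
  obtain ⟨αG, r₁, A₁, hαG, hr₁, hA₁, HG⟩ := exists_block_decay_G1k_diagonal_closed hd L hL hL3 φ hMφ hMφ' hφ hφ' hstar ha ha' hϱ0 hϱ1 τ hτ hCτ hτm hMτ
    hρw hτ₁ hτ₂ hφτ
  obtain ⟨αC, BC, ρC, hαC, hBC, hρC, HC⟩ := exists_local_letter_QGGQInvk_closed hd L hL hL3 φ hMφ hMφ' hφ hφ' ha ha' hϱ0 hϱ1 τ hτ hCτ hρw hτ₁ hτ₂ hφτ hMτ
  obtain ⟨αB, BU, κU, hαB, hBU, hκU, HB⟩ := HU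
  -- one window, one rate
  set αs : ℝ := min (min (min αA αD) αG) (min αC αB) with hαs
  have hαs0 : 0 < αs := lt_min (lt_min (lt_min hαA hαD) hαG) (lt_min hαC hαB)
  set κ : ℝ := min (min (min δA δD) r₁) (min ρC κU) with hκdef
  have hκ0 : 0 < κ := lt_min (lt_min (lt_min hδA hδD) hr₁) (lt_min hρC hκU)
  have hκA : κ ≤ δA := ((min_le_left _ _).trans (min_le_left _ _)).trans (min_le_left _ _)
  have hκD : κ ≤ δD := ((min_le_left _ _).trans (min_le_left _ _)).trans (min_le_right _ _)
  have hκG : κ ≤ r₁ := (min_le_left _ _).trans (min_le_right _ _)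
  have hκC : κ ≤ ρC := (min_le_right _ _).trans (min_le_left _ _)
  have hκB : κ ≤ κU := (min_le_right _ _).trans (min_le_right _ _)
  have hαsA : αs ≤ αA := ((min_le_left _ _).trans (min_le_left _ _)).trans (min_le_left _ _)
  have hαsD : αs ≤ αD := ((min_le_left _ _).trans (min_le_left _ _)).trans (min_le_right _ _)
  have hαsG : αs ≤ αG := (min_le_left _ _).trans (min_le_right _ _)
  have hαsC : αs ≤ αC := (min_le_right _ _).trans (min_le_left _ _)
  have hαsB : αs ≤ αB := (min_le_right _ _).trans (min_le_right _ _)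
  set K : ℝ := latticeConst d ((κ - κ / 2) / 2) with hKdef
  set Bs : ℝ := BDv + BDv * BU * BC * (BU * BA * K * d) * K ^ 3 * (1 + BC * ((BU * Real.sqrt d) * A₁ * (BU * Real.sqrt d) * K ^ 2 * 1) * K ^ 2)
    with hBs
  have hK0 : 0 ≤ K := latticeConst_nonneg d (div_nonneg (by linarith) (by norm_num))
  have hBs0 : 0 ≤ Bs := by positivity
  refine ⟨αs, Bs, κ / 2, hαs0, hBs0, by positivity, ?_⟩
  intro n η hηL c₀ c₁ _ _ hw hρ m _ hm U αU hα0 hα1 hU1 hreg εU hεU hUε hLb α hα hαle hUst hUb hUη hpl hUgrad hRlev hεg hAQ hpos' hpos v f F hfv hfF μ b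
  have hc₀ : (0 : ℝ) < c₀ := Fact.out
  have hc₁ : (0 : ℝ) < c₁ := Fact.out
  have hF0 : 0 ≤ F := (norm_nonneg _).trans (hfF b)
  have hRS : ∀ (b : Bond d (towerP L m (n + 1))) (v u : W), ⟪adTransportW φ U b v, u⟫_ℂ = ⟪v, adTransportW φ (fun b => (U b)⁻¹) b u⟫_ℂ :=
    adTransportW_adjoint φ τ hτ₂ hUst hφτ
  -- the local part, its positivity, the Woodbury letters
  obtain ⟨A₀, hA₀⟩ : ∃ A₀ : BondL2K ℂ d (towerP L m (n + 1)) c₀ W →ₗ[ℂ] BondL2K ℂ d (towerP L m (n + 1)) c₀ W,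
      A₀ = hessOp φ η U τ + covDerivL2K ℂ c₀ ((η : ℂ))⁻¹ (adTransportW φ U) ∘ₗ covDivL2K ℂ c₀ ((η : ℂ))⁻¹ (adTransportW φ fun b => (U b)⁻¹) +
        LinearMap.adjoint (QkW L m n φ U hL αU hα1 hU1 hreg (c₀ := c₀) (c₁ := c₁)) ∘ₗ ((a : ℂ) • QkW L m n φ U hL αU hα1 hU1 hreg (c₀ := c₀) (c₁ := c₁)) :=
    ⟨_, rfl⟩
  have hpos₀ : ∀ x : BondL2K ℂ d (towerP L m (n + 1)) c₀ W, x ≠ 0 → 0 < RCLike.re ⟪x, A₀ x⟫_ℂ :=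
    localK_pos_of_pos L m n φ η U τ hRS hL αU hα1 hU1 hreg a A₀ hA₀ hpos
  obtain ⟨Uu, hUu⟩ : ∃ Uu : SiteL2K ℂ d m c₁ W →ₗ[ℂ] BondL2K ℂ d (towerP L m (n + 1)) c₀ W,
      Uu = covDerivL2K ℂ c₀ ((η : ℂ))⁻¹ (adTransportW φ U) ∘ₗ GpOfUk L m n φ η U a' (c₁ := c₁) hpos' ∘ₗ
        LinearMap.adjoint ((WL2.linearEquiv ℂ ℂ (fun _ : TSite d m => c₁)).symm.toLinearMap ∘ₗ QprimeTowerW L m n φ U (c₀ := c₀)) := ⟨_, rfl⟩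
  obtain ⟨V, hV⟩ : ∃ V : BondL2K ℂ d (towerP L m (n + 1)) c₀ W →ₗ[ℂ] SiteL2K ℂ d m c₁ W,
      V = ((WL2.linearEquiv ℂ ℂ (fun _ : TSite d m => c₁)).symm.toLinearMap ∘ₗ QprimeTowerW L m n φ U (c₀ := c₀)) ∘ₗ
        GpOfUk L m n φ η U a' (c₁ := c₁) hpos' ∘ₗ covDivL2K ℂ c₀ ((η : ℂ))⁻¹ (adTransportW φ fun b => (U b)⁻¹) := ⟨_, rfl⟩
  obtain ⟨c, hc⟩ : ∃ c : SiteL2K ℂ d m c₁ W →ₗ[ℂ] SiteL2K ℂ d m c₁ W, c = greenK _ (QGGQk_pos L m n φ c₀ η U c₁ a' hRS hpos') := ⟨_, rfl⟩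
  have hWST := G1k_eq_woodbury L m n φ c₀ η U c₁ a' τ hRS hpos' hL αU hα1 hU1 hreg a A₀ hA₀ Uu hUu V hV hpos hpos₀
  -- the block families
  obtain ⟨PB, hPB⟩ := exists_block_clm_family (𝕜 := ℂ) (w := fun _ : Bond d (towerP L m (n + 1)) => c₀) (V := W)
    (fun b : Bond d (towerP L m (n + 1)) => blockCoord (L ^ (n + 1)) m (siteCast (towerP_eq_fineP_pow L m (n + 1)) (bpos b)))
  obtain ⟨rY, hrY⟩ := exists_block_clm_family (𝕜 := ℂ) (w := fun _ : TSite d m => c₁) (V := W) (id : TSite d m → TSite d m)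
  -- the CLMs (+ the slice derivative `D : u ↦ D_U u_μ`)
  obtain ⟨Acl, hAcl⟩ : ∃ T : BondL2K ℂ d (towerP L m (n + 1)) c₀ W →L[ℂ] BondL2K ℂ d (towerP L m (n + 1)) c₀ W,
      T = LinearMap.toContinuousLinearMap (greenK A₀ hpos₀) := ⟨_, rfl⟩
  obtain ⟨Gcl, hGcl⟩ : ∃ T : BondL2K ℂ d (towerP L m (n + 1)) c₀ W →L[ℂ] BondL2K ℂ d (towerP L m (n + 1)) c₀ W,
      T = LinearMap.toContinuousLinearMap (G1k L m n φ η U hL αU hα1 hU1 hreg τ (c₀ := c₀) (c₁ := c₁) hpos) := ⟨_, rfl⟩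
  obtain ⟨Ucl, hUcl⟩ : ∃ T : SiteL2K ℂ d m c₁ W →L[ℂ] BondL2K ℂ d (towerP L m (n + 1)) c₀ W, T = LinearMap.toContinuousLinearMap Uu := ⟨_, rfl⟩
  obtain ⟨Vcl, hVcl⟩ : ∃ T : BondL2K ℂ d (towerP L m (n + 1)) c₀ W →L[ℂ] SiteL2K ℂ d m c₁ W, T = LinearMap.toContinuousLinearMap V := ⟨_, rfl⟩
  obtain ⟨Ccl, hCcl⟩ : ∃ T : SiteL2K ℂ d m c₁ W →L[ℂ] SiteL2K ℂ d m c₁ W, T = LinearMap.toContinuousLinearMap c := ⟨_, rfl⟩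
  obtain ⟨Dcl, hDcl⟩ : ∃ T : BondL2K ℂ d (towerP L m (n + 1)) c₀ W →L[ℂ] BondL2K ℂ d (towerP L m (n + 1)) c₀ W,
      ∀ (u : BondL2K ℂ d (towerP L m (n + 1)) c₀ W) (b' : Bond d (towerP L m (n + 1))),
        WL2.equiv ℂ (fun _ : Bond d (towerP L m (n + 1)) => c₀) W (T u) b' = WL2.equiv ℂ (fun _ : Bond d (towerP L m (n + 1)) => c₀) W (covDerivL2K ℂ c₀ ((η : ℂ))⁻¹ (adTransportW φ U) ((WL2.equiv ℂ (fun _ : TSite d (towerP L m (n + 1)) => c₀) W).symm fun y => WL2.equiv ℂ (fun _ : Bond d (towerP L m (n + 1)) => c₀) W u (y, μ))) b' :=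
    ⟨LinearMap.toContinuousLinearMap (covDerivL2K ℂ c₀ ((η : ℂ))⁻¹ (adTransportW φ U) ∘ₗ
        (WL2.linearEquiv ℂ ℂ (fun _ : TSite d (towerP L m (n + 1)) => c₀)).symm.toLinearMap ∘ₗ
        LinearMap.funLeft ℂ W (fun y : TSite d (towerP L m (n + 1)) => ((y, μ) : Bond d (towerP L m (n + 1)))) ∘ₗ
        (WL2.linearEquiv ℂ ℂ (fun _ : Bond d (towerP L m (n + 1)) => c₀)).toLinearMap), fun _ _ => rfl⟩
  -- hW pointwise
  have hW : ∀ f', Gcl f' = Acl f' + Acl (Ucl ((Ccl + Ccl ∘L Vcl ∘L Gcl ∘L Ucl ∘L Ccl) (Vcl (Acl f')))) := fun f' => by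
    have e := congrArg (fun T : BondL2K ℂ d (towerP L m (n + 1)) c₀ W →ₗ[ℂ] BondL2K ℂ d (towerP L m (n + 1)) c₀ W => T f') hWST
    simp only [LinearMap.add_apply, LinearMap.comp_apply] at e
    simp only [hAcl, hGcl, hUcl, hVcl, hCcl, hc, add_apply, ContinuousLinearMap.comp_apply, LinearMap.coe_toContinuousLinearMap']
    exact e
  -- the adjoint facts
  have hVadj : ContinuousLinearMap.adjoint Ucl = Vcl := by
    rw [hUcl, hVcl]; exact adjoint_toContinuousLinearMap_Uu L m n φ c₀ η U c₁ a' hRS hpos' Uu hUu V hV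
  have hAadj : ContinuousLinearMap.adjoint Acl = Acl := by
    rw [hAcl]; exact (adjoint_localInvK L m n φ c₀ η U c₁ τ hL αU hα1 hU1 hreg a hUst hτ₁ hτ₂ hφτ A₀ hA₀ hpos₀).2
  -- the five letters at this height, weakened to the common rate `κ`
  have hAk : ∀ (v : TSite d m) (f : BondL2K ℂ d (towerP L m (n + 1)) c₀ W) (F : ℝ),
      (∀ x, blockCoord (L ^ (n + 1)) m (siteCast (towerP_eq_fineP_pow L m (n + 1)) (bpos x)) ≠ v →
        WL2.equiv ℂ (fun _ : Bond d (towerP L m (n + 1)) => c₀) W f x = 0) →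
      (∀ x, ‖WL2.equiv ℂ (fun _ : Bond d (towerP L m (n + 1)) => c₀) W f x‖ ≤ F) →
      ∀ x, ‖WL2.equiv ℂ (fun _ : Bond d (towerP L m (n + 1)) => c₀) W (Acl f) x‖ ≤
        BA * Real.exp (-(κ * tdist m (blockCoord (L ^ (n + 1)) m (siteCast (towerP_eq_fineP_pow L m (n + 1)) (bpos x))) v)) * F := by
    intro v f F hfv hfF x
    have hF : 0 ≤ F := (norm_nonneg _).trans (hfF x)
    have h := HA n η hηL c₀ c₁ hw hρ m hm U αU hα0 hα1 hU1 hreg εU hεU hUε hLb α hα (hαle.trans hαsA)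
      hUst hUb hUη hpl hεg hAQ A₀ hA₀ hpos₀ PB hPB v f hfv F hF hfF x
    rw [hAcl, LinearMap.coe_toContinuousLinearMap']
    exact h.trans (mul_le_mul_of_nonneg_right (mul_le_mul_of_nonneg_left (Real.exp_le_exp.2 (neg_le_neg (mul_le_mul_of_nonneg_right hκA (tdist_nonneg m _ _)))) hBA) hF)
  have hDAk : ∀ (v : TSite d m) (f : BondL2K ℂ d (towerP L m (n + 1)) c₀ W) (F : ℝ),
      (∀ x, blockCoord (L ^ (n + 1)) m (siteCast (towerP_eq_fineP_pow L m (n + 1)) (bpos x)) ≠ v →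
        WL2.equiv ℂ (fun _ : Bond d (towerP L m (n + 1)) => c₀) W f x = 0) →
      (∀ x, ‖WL2.equiv ℂ (fun _ : Bond d (towerP L m (n + 1)) => c₀) W f x‖ ≤ F) →
      ∀ x, ‖WL2.equiv ℂ (fun _ : Bond d (towerP L m (n + 1)) => c₀) W ((Dcl ∘L Acl) f) x‖ ≤
        BDv * Real.exp (-(κ * tdist m (blockCoord (L ^ (n + 1)) m (siteCast (towerP_eq_fineP_pow L m (n + 1)) (btgt x))) v)) * F := by
    intro v f F hfv hfF x
    have hF : 0 ≤ F := (norm_nonneg _).trans (hfF x)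
    have h := (HD n η hηL c₀ c₁ hw hρ m hm U αU hα0 hα1 hU1 hreg εU hεU hUε hLb α hα (hαle.trans hαsD)
      hUst hUb hUη hpl hUgrad hεg hAQ A₀ hA₀ hpos₀ PB hPB v f hfv F hF hfF μ x).1
    rw [ContinuousLinearMap.comp_apply, hDcl, hAcl, LinearMap.coe_toContinuousLinearMap']
    calc _ ≤ BDv * Real.exp (-(δD * tdist m (blockCoord (L ^ (n + 1)) m (siteCast (towerP_eq_fineP_pow L m (n + 1)) (btgt x))) v)) * F := h
      _ ≤ _ := mul_le_mul_of_nonneg_right (mul_le_mul_of_nonneg_left (Real.exp_le_exp.2 (neg_le_neg (mul_le_mul_of_nonneg_right hκD (tdist_nonneg m _ _)))) hBDv) hF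
  have hUk : ∀ (v : TSite d m) (g : SiteL2K ℂ d m c₁ W) (F : ℝ), (∀ u, id u ≠ v → WL2.equiv ℂ (fun _ : TSite d m => c₁) W g u = 0) →
      (∀ u, ‖WL2.equiv ℂ (fun _ : TSite d m => c₁) W g u‖ ≤ F) →
      ∀ x, ‖WL2.equiv ℂ (fun _ : Bond d (towerP L m (n + 1)) => c₀) W (Ucl g) x‖ ≤
        BU * Real.exp (-(κ * tdist m (blockCoord (L ^ (n + 1)) m (siteCast (towerP_eq_fineP_pow L m (n + 1)) (bpos x))) v)) * F := by
    intro v g F hgv hgF x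
    obtain ⟨y₀⟩ : Nonempty (TSite d m) := ⟨v⟩
    have hF : 0 ≤ F := (norm_nonneg _).trans (hgF v)
    have h := HB n η hηL c₀ c₁ hw hρ m hm U αU hα0 hα1 hU1 hreg εU hεU hUε hLb α hα (hαle.trans hαsB)
      hUst hUb hUη hpl hUgrad hRlev hεg hAQ hpos' v g F (fun y hy => hgv y hy) hgF x
    rw [hUcl, LinearMap.coe_toContinuousLinearMap', hUu]
    exact h.trans (mul_le_mul_of_nonneg_right (mul_le_mul_of_nonneg_left (Real.exp_le_exp.2 (neg_le_neg (mul_le_mul_of_nonneg_right hκB (tdist_nonneg m _ _)))) hBU) hF)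
  have hCk : ∀ (v : TSite d m) (g : SiteL2K ℂ d m c₁ W) (F : ℝ), (∀ u, id u ≠ v → WL2.equiv ℂ (fun _ : TSite d m => c₁) W g u = 0) →
      (∀ u, ‖WL2.equiv ℂ (fun _ : TSite d m => c₁) W g u‖ ≤ F) →
      ∀ u, ‖WL2.equiv ℂ (fun _ : TSite d m => c₁) W (Ccl g) u‖ ≤ BC * Real.exp (-(κ * tdist m (id u) v)) * F := by
    intro v g F hgv hgF u
    have hF : 0 ≤ F := (norm_nonneg _).trans (hgF v)
    have h := HC n η hηL c₀ c₁ hw hρ m hm U αU hα1 hU1 hreg εU hεU hUε hLb α hα (hαle.trans hαsC)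
      hUst hUb hUη hpl hεg hpos' rY hrY v g F (fun y hy => hgv y hy) hgF u
    rw [hCcl, LinearMap.coe_toContinuousLinearMap', hc]
    exact h.trans (mul_le_mul_of_nonneg_right (mul_le_mul_of_nonneg_left (Real.exp_le_exp.2 (neg_le_neg (mul_le_mul_of_nonneg_right hκC (tdist_nonneg m _ _)))) hBC) hF)
  have hGk : ∀ z z', ‖PB z' ∘L Gcl ∘L PB z‖ ≤ A₁ * Real.exp (-(κ * tdist m z z')) := by
    intro z z'
    rw [hGcl]
    have h := HG n η hηL c₀ c₁ hw hρ m hm U αU hα0 hα1 hU1 hreg εU hεU hUε hLb α hα (hαle.trans hαsG)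
      hUst hUb hUη hpl hεg hpos PB hPB z z'
    exact h.trans (mul_le_mul_of_nonneg_left (Real.exp_le_exp.2 (neg_le_neg (mul_le_mul_of_nonneg_right hκG (tdist_nonneg m _ _)))) hA₁)
  -- the bond-block mass `d·c₁`
  have hμB : ∀ u : TSite d m, ∑ x : Bond d (towerP L m (n + 1)),
      (if blockCoord (L ^ (n + 1)) m (siteCast (towerP_eq_fineP_pow L m (n + 1)) (bpos x)) = u then c₀ else 0) ≤ (d : ℝ) * c₁ := by
    intro u
    have h := sum_bondMass_bigBlock_le L m n hc₀.le u
    calc _ ≤ c₀ * (d * ((L : ℝ) ^ (n + 1)) ^ d) := h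
      _ = (d : ℝ) * c₁ := by rw [← hw]; ring
  -- the assembly, post-composed by the slice derivative, output blocks `Π∘btgt`
  haveI : Nonempty (Bond d (towerP L m (n + 1))) := ⟨b⟩
  have hκ' : κ / 2 < κ := by linarith
  have h := local_letter_postcomp_torus_const (𝕜 := ℂ) (V := W) (VX := W)
    (fun x : Bond d (towerP L m (n + 1)) => blockCoord (L ^ (n + 1)) m (siteCast (towerP_eq_fineP_pow L m (n + 1)) (bpos x)))
    (fun x : Bond d (towerP L m (n + 1)) => blockCoord (L ^ (n + 1)) m (siteCast (towerP_eq_fineP_pow L m (n + 1)) (btgt x))) hPB hrY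
    Acl Gcl Ucl Vcl Ccl Dcl hm hW hVadj hAadj (dB := d) hBDv hBA hBU hBC hA₁ (by positivity) hκ' hc₁ (fun _ => rfl) (Nat.cast_nonneg d) hμB
    hDAk hAk hUk hCk hGk v f F hfv hfF b
  rw [hDcl, hGcl, LinearMap.coe_toContinuousLinearMap'] at h
  exact ⟨h, norm_covGrad_apply_le_of_slice _ _ _ b μ h⟩

include hd hL hL3 hMφ hMφ' hφ hφ' hstar ha ha' hϱ0 hϱ1 hτ hCτ hτm hMτ hρw hτ₁ hτ₂ hφτ in
/-- **THE SLICE-GRADIENT ROW OF `G₁,k(U)` ON PRINT's DIAGONAL — `exists_local_gradLetter_G1k`, UNCONDITIONAL on the cell's MODEL letters**: §1 with `HU` INHABITED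
exactly as (K64) §2 (the NE9 owner's `B9Eq342GreenPrimeTowerGradientRowClosed.exists_gradRow_GpOfUk` on the unit point sources `h = Q̃′_k†g`: support in the big block
over `v`, size `‖h‖_∞ ≤ ‖g‖_∞` on the diagonal, tip → base junction `e^{κ′}`).  For every height, period, background of the model letters in one window `α ≤ α₁`, ANY
positivity witnesses, every source `f` supported over ONE unit block `v` with `‖f‖_∞ ≤ F`, every component `μ` and bond `b`:
`‖(D_U(G₁,kf)_μ)(b)‖ ≤ B·e^{−δ·d_m(Π(b₊),v)}·F` and `‖(∇_UG₁,kf)(b, μ)‖ ≤ B·e^{−δ·d_m(Π(b₊),v)}·F`. [cite: Balaban1985BackgroundPropagators, Thm 3.3 p.399, Thm 3.1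
(3.42) p.397, (3.3) p.391, (3.25)–(3.26) pp.394–395, (3.19) p.393, Thm 3.11 p.416, Thm 3.13 p.426; Balaban1985Variational, (115) p.294, (117) p.295] -/
theorem exists_local_gradLetter_G1k :
    ∃ α₁ B δ : ℝ, 0 < α₁ ∧ 0 ≤ B ∧ 0 < δ ∧
      ∀ (n : ℕ) (η : ℝ) (_hηL : η * (L : ℝ) ^ (n + 1) = 1) (c₀ c₁ : ℝ) [Fact (0 < c₀)] [Fact (0 < c₁)]
        (_hw : c₀ * ((L : ℝ) ^ (n + 1)) ^ d = c₁) (_hρ : |η| ^ d / c₀ ≤ ρw) (m : Fin d → ℕ) [∀ i, NeZero (m i)] (_hm : ∀ i, 1 ≤ m i)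
        (U : Bond d (towerP L m (n + 1)) → 𝔸ˣ) (αU : ℕ → ℝ) (_hα0 : ∀ j, 0 ≤ αU j) (hα1 : ∀ j, αU j ≤ 1 / 64)
        (hU1 : ∀ (j : ℕ) (x : B7Prop1Explicit.Site d) (k : Fin d), perCfg (towerP L m (j + 1)) (UlevOf L m (n + 1) U j) x k ∈ U1 𝔸)
        (hreg : ∀ (j : ℕ) (y : TSite d (towerP L m j)) (k : Fin d) (ρ' : Fin d → Fin L),
          ‖((Wcx L (perCfg (towerP L m (j + 1)) (UlevOf L m (n + 1) U j)) (cornerSite L y) k (boxVec L ρ') : 𝔸ˣ) : 𝔸) - 1‖ ≤ αU j)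
        (εU : ℕ → ℝ) (_hεU : ∀ j, 0 ≤ εU j) (_hUε : ∀ (j : ℕ) (b : Bond d (towerP L m (j + 1))), ‖(UlevOf L m (n + 1) U j b : 𝔸) - 1‖ ≤ εU j)
        (_hLb : ∀ (j : ℕ) (b : Bond d (towerP L m (j + 1))), UlevOf L m (n + 1) U j b ∈ U1 𝔸)
        (α : ℝ) (_hα : 0 ≤ α) (_hαle : α ≤ α₁)
        (hUst : ∀ b, star (U b : 𝔸) = (((U b)⁻¹ : 𝔸ˣ) : 𝔸)) (_hUb : ∀ b, U b ∈ U1 𝔸) (_hUη : ∀ b, ‖(U b : 𝔸) - 1‖ ≤ α * η)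
        (_hpl : ∀ p : B9SectCLatticeCarrier.Plaq d (towerP L m (n + 1)), ‖(plaqHolU U p : 𝔸) - 1‖ ≤ α * η ^ 2)
        (_hUgrad : ∀ (x : TSite d (towerP L m (n + 1))) (μ : Fin d), ‖(U (x, μ) : 𝔸) - U (unshift μ x, μ)‖ ≤ α * η ^ 2)
        (_hRlev : ∀ (j : ℕ) (b : Bond d (towerP L m (j + 1))) (w : W), ‖adTransportW φ (UlevOf L m (n + 1) U j) b w‖ ≤ ‖w‖)
        (_hεg : ∀ j < n + 1, εU j ≤ α * ϱ ^ j) (_hAQ : ∑ j ∈ Finset.range (n + 1), αU j ≤ AQ)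
        (hpos' : ∀ x : SiteL2K ℂ d (towerP L m (n + 1)) c₀ W, x ≠ 0 → 0 < RCLike.re ⟪x, laplacePrimeAk L m n φ η U a' (c₁ := c₁) x⟫_ℂ)
        (hpos : ∀ x : BondL2K ℂ d (towerP L m (n + 1)) c₀ W, x ≠ 0 →
          0 < RCLike.re ⟪x, laplaceAk L m n φ η U hL αU hα1 hU1 hreg τ (c₀ := c₀) (c₁ := c₁) a x⟫_ℂ)
        (v : TSite d m) (f : BondL2K ℂ d (towerP L m (n + 1)) c₀ W) (F : ℝ)
        (_hfv : ∀ b, blockCoord (L ^ (n + 1)) m (siteCast (towerP_eq_fineP_pow L m (n + 1)) (bpos b)) ≠ v →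
          WL2.equiv ℂ (fun _ : Bond d (towerP L m (n + 1)) => c₀) W f b = 0)
        (_hfF : ∀ b, ‖WL2.equiv ℂ (fun _ : Bond d (towerP L m (n + 1)) => c₀) W f b‖ ≤ F) (μ : Fin d) (b : Bond d (towerP L m (n + 1))),
        ‖WL2.equiv ℂ (fun _ : Bond d (towerP L m (n + 1)) => c₀) W (covDerivL2K ℂ c₀ ((η : ℂ))⁻¹ (adTransportW φ U) ((WL2.equiv ℂ (fun _ : TSite d (towerP L m (n + 1)) => c₀) W).symm fun y => WL2.equiv ℂ (fun _ : Bond d (towerP L m (n + 1)) => c₀) W (G1k L m n φ η U hL αU hα1 hU1 hreg τ (c₀ := c₀) (c₁ := c₁) hpos f) (y, μ))) b‖ ≤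
            B * Real.exp (-(δ * tdist m (blockCoord (L ^ (n + 1)) m (siteCast (towerP_eq_fineP_pow L m (n + 1)) (btgt b))) v)) * F ∧
          ‖covGrad ((η : ℂ))⁻¹ (adTransportW φ U) (WL2.equiv ℂ (fun _ : Bond d (towerP L m (n + 1)) => c₀) W (G1k L m n φ η U hL αU hα1 hU1 hreg τ (c₀ := c₀) (c₁ := c₁) hpos f)) (b, μ)‖ ≤
            B * Real.exp (-(δ * tdist m (blockCoord (L ^ (n + 1)) m (siteCast (towerP_eq_fineP_pow L m (n + 1)) (btgt b))) v)) * F := by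
  classical
  have hL2 : 2 ≤ L := le_trans (by norm_num) hL3
  obtain ⟨α₂, BD, κ', hα₂, hBD, hκ', HD⟩ := exists_gradRow_GpOfUk L φ hMφ hMφ' hφ hφ' ha' hϱ0 hϱ1 τ hτ₂ hφτ hd hL2
  refine exists_local_gradLetter_G1k_of_UuLetter hd L hL hL3 φ hMφ hMφ' hφ hφ' hstar ha ha' hϱ0 hϱ1 τ hτ hCτ hτm hMτ hρw hτ₁ hτ₂ hφτ AQ
    ⟨α₂, BD * Real.exp κ', κ', hα₂, by positivity, hκ', ?_⟩
  intro n η hηL c₀ c₁ _ _ hw hρ m _ hm U αU hα0 hα1 hU1 hreg εU hεU hUε hLb α hα hαle hUst hUb hUη hpl hUgrad hRlev hεg hAQ hpos' v g Gs hgv hgG b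
  have hc₀ : (0 : ℝ) < c₀ := Fact.out
  have hc₁ : (0 : ℝ) < c₁ := Fact.out
  have hG0 : 0 ≤ Gs := (norm_nonneg _).trans (hgG v)
  have hRS : ∀ (b : Bond d (towerP L m (n + 1))) (v u : W), ⟪adTransportW φ U b v, u⟫_ℂ = ⟪v, adTransportW φ (fun b => (U b)⁻¹) b u⟫_ℂ :=
    adTransportW_adjoint φ τ hτ₂ hUst hφτ
  -- the site block family the gradient row wants
  obtain ⟨PS, hPS⟩ := exists_block_clm_family (𝕜 := ℂ) (w := fun _ : TSite d (towerP L m (n + 1)) => c₀) (V := W)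
    (fun x : TSite d (towerP L m (n + 1)) => blockCoord (L ^ (n + 1)) m (siteCast (towerP_eq_fineP_pow L m (n + 1)) x))
  -- `h := Q̃′_k†g`: supported in the big block over `v`, bounded by `G` on the diagonal
  set h : SiteL2K ℂ d (towerP L m (n + 1)) c₀ W :=
    LinearMap.adjoint ((WL2.linearEquiv ℂ ℂ (fun _ : TSite d m => c₁)).symm.toLinearMap ∘ₗ QprimeTowerW L m n φ U (c₀ := c₀)) g with hh
  have hsupp : ∀ x, blockCoord (L ^ (n + 1)) m (siteCast (towerP_eq_fineP_pow L m (n + 1)) x) ≠ v →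
      WL2.equiv ℂ (fun _ : TSite d (towerP L m (n + 1)) => c₀) W h x = 0 := by
    intro x hx
    have e := adjoint_QtildeTower_apply_eq_of_eq_at L m n φ (c₀ := c₀) U g 0 x (fun z hz => by
      have hz' : blockCoord (L ^ (n + 1)) m (siteCast (towerP_eq_fineP_pow L m (n + 1)) x) = z := (bigBlock_eq_iff L m n x z).2 hz
      have hzv : z ≠ v := fun hzv => hx (hz'.trans hzv)
      rw [hgv z hzv, WL2.equiv_zero, Pi.zero_apply])
    rw [hh, e, map_zero, WL2.equiv_zero, Pi.zero_apply]
  have hμ : ∑ y : TSite d m, (if id y = v then c₁ else 0) ≤ c₁ := by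
    show ∑ y : TSite d m, (if y = v then c₁ else 0) ≤ c₁
    rw [Finset.sum_ite_eq' Finset.univ v (fun _ => c₁), if_pos (Finset.mem_univ _)]
  have hgn : ‖g‖ ≤ Real.sqrt c₁ * Gs := norm_le_sqrt_mass_mul (π := id) (w := fun _ : TSite d m => c₁) v hμ g hG0 (fun y hy => hgv y hy) hgG
  have hsize : ∀ x, ‖WL2.equiv ℂ (fun _ : TSite d (towerP L m (n + 1)) => c₀) W h x‖ ≤ Gs := by
    intro x
    have e := norm_adjoint_QtildeTower_apply_le L m n φ (c₀ := c₀) U hRlev g x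
    rw [hh]
    refine e.trans ?_
    have hLp : (0 : ℝ) < ((L : ℝ) ^ (n + 1)) ^ d := by positivity
    calc Real.sqrt c₁ * (((L : ℝ) ^ (n + 1)) ^ d)⁻¹ / c₀ * ‖g‖
        ≤ Real.sqrt c₁ * (((L : ℝ) ^ (n + 1)) ^ d)⁻¹ / c₀ * (Real.sqrt c₁ * Gs) := by gcongr
      _ = c₁ / (c₀ * ((L : ℝ) ^ (n + 1)) ^ d) * Gs := by
          rw [show Real.sqrt c₁ * (((L : ℝ) ^ (n + 1)) ^ d)⁻¹ / c₀ * (Real.sqrt c₁ * Gs) =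
            Real.sqrt c₁ * Real.sqrt c₁ * ((((L : ℝ) ^ (n + 1)) ^ d)⁻¹ / c₀) * Gs by ring, Real.mul_self_sqrt hc₁.le]
          field_simp
      _ = Gs := by rw [← hw, div_self (ne_of_gt (by positivity)), one_mul]
  -- the owner's gradient row at `h`, then the tip → base junction
  have hrow := HD n η hηL c₀ c₁ hw m U hRS α hα hαle hUb hUη hUgrad εU hεU hεg hUε hLb hUst hRlev hpos' PS hPS v h Gs hG0 hsupp hsize b
  have hone := tdist_bigBlock_bpos_btgt_le_one (L := L) (m := m) (k := n + 1) hm b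
  have htri := tdist_triangle hm (blockCoord (L ^ (n + 1)) m (siteCast (towerP_eq_fineP_pow L m (n + 1)) (bpos b)))
    (blockCoord (L ^ (n + 1)) m (siteCast (towerP_eq_fineP_pow L m (n + 1)) (btgt b))) v
  have hexp : Real.exp (-(κ' * tdist m (blockCoord (L ^ (n + 1)) m (siteCast (towerP_eq_fineP_pow L m (n + 1)) (btgt b))) v)) ≤
      Real.exp κ' * Real.exp (-(κ' * tdist m (blockCoord (L ^ (n + 1)) m (siteCast (towerP_eq_fineP_pow L m (n + 1)) (bpos b))) v)) := by
    rw [← Real.exp_add]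
    exact Real.exp_le_exp.2 (by nlinarith [hκ'.le])
  have e : (covDerivL2K ℂ c₀ ((η : ℂ))⁻¹ (adTransportW φ U) ∘ₗ GpOfUk L m n φ η U a' (c₁ := c₁) hpos' ∘ₗ
      LinearMap.adjoint ((WL2.linearEquiv ℂ ℂ (fun _ : TSite d m => c₁)).symm.toLinearMap ∘ₗ QprimeTowerW L m n φ U (c₀ := c₀))) g =
      covDerivL2K ℂ c₀ ((η : ℂ))⁻¹ (adTransportW φ U) (GpOfUk L m n φ η U a' (c₁ := c₁) hpos' h) := by
    rw [hh]; rfl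
  rw [e]
  calc _ ≤ BD * Gs * Real.exp (-(κ' * tdist m (blockCoord (L ^ (n + 1)) m (siteCast (towerP_eq_fineP_pow L m (n + 1)) (btgt b))) v)) := hrow
    _ ≤ BD * Gs * (Real.exp κ' * Real.exp (-(κ' * tdist m (blockCoord (L ^ (n + 1)) m (siteCast (towerP_eq_fineP_pow L m (n + 1)) (bpos b))) v))) :=
        mul_le_mul_of_nonneg_left hexp (mul_nonneg hBD hG0)
    _ = BD * Real.exp κ' * Real.exp (-(κ' * tdist m (blockCoord (L ^ (n + 1)) m (siteCast (towerP_eq_fineP_pow L m (n + 1)) (bpos b))) v)) * Gs := by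
        ring

end Literature.MathematicalPhysics.QuantumFieldTheory.Balaban1983to89.B9Eq326G1kSliceGradRowClosed

end
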